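import Summits.ResolutionOfSingularities.ResolutionOfSingularities.Theorems.WallFrames5
import Summits.ResolutionOfSingularities.ResolutionOfSingularities.Theorems.NearCutCompanion3
import Summits.ResolutionOfSingularities.ResolutionOfSingularities.Theorems.NearCutWalls2
import Summits.ResolutionOfSingularities.ResolutionOfSingularities.Theorems.ProximityCutArcLaw
import Summits.ResolutionOfSingularities.ResolutionOfSingularities.Theorems.MaxContactCutBoundaryLedger
import Summits.ResolutionOfSingularities.ResolutionOfSingularities.Theorems.MaxContactCutWallCut
import Summits.ResolutionOfSingularities.ResolutionOfSingularities.Theorems.PlanarGhostDescent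
import Literature.AlgebraicGeometry.Resolution.PointBlowupIFPGiraud
import Literature.AlgebraicGeometry.Resolution.AdicNoetherian
import HarnessLib

/-!
# WallFrames (6/17) — Kollár's wall descent in a polynomial frame; sections: Tame (cont.), Isolation, IsolationTop

Verbatim slice of the farm-checked monolith `WallFrames.lean` of cell `decomp-res`, seat `decomp-res-lens-5`, g35
(sha256 7405a21d81d102a4…, monolith lines 1349–1610); one namespace `Summit.ResolutionOfSingularities.ResolutionOfSingularities.Theorems.WallFrames` across the
slices, imports chained.  The monolith's module docstring (laws W1–W7, mechanism, novelty, honest placement) is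
reproduced in slice 1; the main theorem `balancedWallPort_holds : WallCut.BalancedWallPort` (hypothesis-free) and the
host-route corollary `ecBalancedWallPort_holds` (aside item 27368 of route MaxContactCut) are in slice 16/17.
-/

open MvPolynomial Finset
open scoped BigOperators
open Literature.AlgebraicGeometry.Resolution
open Literature.AlgebraicGeometry.Resolution.Hauser2010
open Literature.AlgebraicGeometry.Resolution.PointBlowup
open Literature.AlgebraicGeometry.Resolution.HauserPerlega2024

namespace Summit.ResolutionOfSingularities.ResolutionOfSingularities.Theorems.WallFrames

variable {σ : Type*} [Fintype σ] [DecidableEq σ] {K : Type*} [Field K]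

section Tame

omit [Fintype σ] in
/-- The `y_f^n`-coefficient of the `n`-th power of a linear form is `α_f^n`. [folklore] -/
theorem coeff_single_pow_of_isHomogeneous_one (f : σ) {ℓ : MvPolynomial σ K} (hℓ : ℓ.IsHomogeneous 1) (n : ℕ) :
    coeff (Finsupp.single f n) (ℓ ^ n) = coeff (Finsupp.single f 1) ℓ ^ n := by
  classical
  induction n with
  | zero => rw [pow_zero, pow_zero, Finsupp.single_zero, ← C_1, coeff_C, if_pos rfl]
  | succ n ih =>
    rw [pow_succ', pow_succ', coeff_mul, Finsupp.antidiagonal_single, Finset.sum_map,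
      Finset.sum_eq_single (1, n)]
    · simp only [Function.Embedding.coe_prodMap, Function.Embedding.coeFn_mk, Prod.map_fst, Prod.map_snd]
      rw [ih]
    · intro kl hkl hne
      simp only [Function.Embedding.coe_prodMap, Function.Embedding.coeFn_mk, Prod.map_fst, Prod.map_snd]
      have hk : kl.1 ≠ 1 := by
        intro h1
        apply hne
        have h2 : kl.2 = n := by
          have := Finset.HasAntidiagonal.mem_antidiagonal.mp hkl
          omega
        exact Prod.ext h1 h2
      rw [hℓ.coeff_eq_zero (by rw [Finsupp.degree_single]; exact hk), zero_mul]
    · intro h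
      exact absurd (Finset.HasAntidiagonal.mem_antidiagonal.mpr (by rw [Nat.add_comm])) h

omit [Fintype σ] in
/-- **TAME INITIAL FRAME LAW.**  If `in_s G = c · ℓ^s` with `ℓ` linear, then
`coeff_{e_f} ∂^{((s-1)e_f)} G = s · c · α_f^s`; in particular it is non-zero when `(s : K) ≠ 0` (tame), `c ≠ 0`
and `α_f ≠ 0`. [new] [Kollar2007 2.59.1, Hasse form] -/
theorem coeff_single_hasseDeriv_of_initialForm (f : σ) {s : ℕ} (hs : 1 ≤ s) {G ℓ : MvPolynomial σ K} {c : K}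
    (hℓ : ℓ.IsHomogeneous 1) (hin : homogeneousComponent s G = C c * ℓ ^ s) :
    coeff (Finsupp.single f 1) (hasseDeriv K (Finsupp.single f (s - 1)) G) =
      (s : K) * c * coeff (Finsupp.single f 1) ℓ ^ s := by
  classical
  have hc : coeff (Finsupp.single f s) G = c * coeff (Finsupp.single f 1) ℓ ^ s := by
    have h := coeff_homogeneousComponent s G (Finsupp.single f s)
    rw [if_pos (Finsupp.degree_single f s), hin, coeff_C_mul, coeff_single_pow_of_isHomogeneous_one f hℓ] at h
    exact h.symm
  rw [coeff_single_hasseDeriv_pred f hs, hc, mul_assoc]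

omit [Fintype σ] in
/-- Corollary: on a tame plateau the lineage germ `h = ∂^{((s-1)e_f)} G` is `∂_f`-TRANSVERSAL. [new] -/
theorem coeff_single_hasseDeriv_ne_zero (f : σ) {s : ℕ} (hs : 1 ≤ s) {G ℓ : MvPolynomial σ K} {c : K}
    (hℓ : ℓ.IsHomogeneous 1) (hin : homogeneousComponent s G = C c * ℓ ^ s) (hsK : (s : K) ≠ 0) (hc : c ≠ 0)
    (hα : coeff (Finsupp.single f 1) ℓ ≠ 0) :
    coeff (Finsupp.single f 1) (hasseDeriv K (Finsupp.single f (s - 1)) G) ≠ 0 := by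
  rw [coeff_single_hasseDeriv_of_initialForm f hs hℓ hin]
  exact mul_ne_zero (mul_ne_zero hsK hc) (pow_ne_zero _ hα)

omit [Fintype σ] in
/-- … and it vanishes at the origin (`ord G ≥ s > s - 1`), so §4 `exists_jet` applies to it. [folklore, by name] -/
theorem constantCoeff_hasseDeriv_pred_eq_zero (f : σ) {s : ℕ} (hs : 1 ≤ s) {G : MvPolynomial σ K}
    (hG : (s : ℕ∞) ≤ ordZero G) : constantCoeff (hasseDeriv K (Finsupp.single f (s - 1)) G) = 0 := by
  rw [← one_le_ordZero_iff]
  have h := natCast_sub_le_ordZero_hasseDeriv (K := K) (Finsupp.single f (s - 1)) hG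
  rw [Finsupp.degree_single] at h
  have h1 : ((1 : ℕ) : ℕ∞) ≤ ((s - (s - 1) : ℕ) : ℕ∞) := by exact_mod_cast (by omega : 1 ≤ s - (s - 1))
  exact h1.trans h

end Tame

/-! ## §10 The K3 contradiction law: `F ∈ 𝔓^q ⇒ ¬ IsolatedTop q F` for the frame curve `𝔓 = (y_v, y_z − ζ)`

Hasse derivatives of order `< q` map `𝔓^q` into `𝔓` (Leibniz), so `topIdeal q F ⊆ 𝔓`; and `𝔓` misses every
power of the third variable `y_u` times a unit (substitute `y_v ↦ 0`, `y_z ↦ ζ(y_u, 0)`), so the origin is NOT an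
isolated top point.  Combined with §7 this is Kollár's K3 [Kollar2007 2.59.4 (v)] against `ForcedWalk.isolated`. -/

section Isolation

omit [Fintype σ] in
/-- **Leibniz power law.** `∂^{(d)}(I^n) ⊆ I^{n − |d|}` for every ideal `I`. [folklore] -/
theorem hasseDeriv_mem_pow_sub (I : Ideal (MvPolynomial σ K)) :
    ∀ (n : ℕ) {f : MvPolynomial σ K}, f ∈ I ^ n → ∀ d : σ →₀ ℕ, hasseDeriv K d f ∈ I ^ (n - d.degree) := by
  classical
  intro n
  induction n with
  | zero => intro f _ d; simp
  | succ n ih =>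
    intro f hf
    rw [pow_succ'] at hf
    refine Submodule.mul_induction_on hf ?_ ?_
    · intro a ha b hb d
      rw [hasseDeriv_mul]
      refine Ideal.sum_mem _ fun kl hkl => ?_
      have hsum : kl.1 + kl.2 = d := Finset.HasAntidiagonal.mem_antidiagonal.mp hkl
      by_cases h1 : kl.1 = 0
      · have h2 : kl.2 = d := by rw [← hsum, h1, zero_add]
        rw [h1, h2, hasseDeriv_zero_apply]
        have hmem : a * hasseDeriv K d b ∈ I ^ (n - d.degree + 1) := by
          rw [pow_succ']
          exact Ideal.mul_mem_mul ha (ih hb d)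
        exact Ideal.pow_le_pow_right (by omega) hmem
      · have hdeg1 : 1 ≤ kl.1.degree := by
          rw [Nat.one_le_iff_ne_zero]
          exact fun h => h1 ((Finsupp.degree_eq_zero_iff kl.1).mp h)
        have hdeg : d.degree = kl.1.degree + kl.2.degree := by rw [← hsum, map_add]
        exact Ideal.pow_le_pow_right (by omega) (Ideal.mul_mem_left _ _ (ih hb kl.2))
    · intro x y hx hy d
      rw [map_add]
      exact Ideal.add_mem _ (hx d) (hy d)

end Isolation

section IsolationTop

variable {τ : Type} [DecidableEq τ] {L : Type} [Field L] [DecidableEq L]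

omit [DecidableEq L] in
/-- `topIdeal q F ⊆ I` whenever `F ∈ I^q`. [folklore] -/
theorem topIdeal_le_of_mem_pow {I : Ideal (MvPolynomial τ L)} {q : ℕ} {F : MvPolynomial τ L} (hF : F ∈ I ^ q) :
    TightDefectClasses.topIdeal q F ≤ I := by
  unfold TightDefectClasses.topIdeal
  rw [Ideal.span_le]
  rintro _ ⟨d, ⟨-, hdq⟩, rfl⟩
  have h := hasseDeriv_mem_pow_sub I q hF d
  have h1 : I ^ (q - d.degree) ≤ I ^ 1 := Ideal.pow_le_pow_right (by omega)
  simpa using h1 h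

omit [DecidableEq L] in
/-- **K3 CONTRADICTION LAW.**  If `F ∈ (y_v, y_z − ζ)^q` with `ζ` `z`-free of order `≥ 1` and a third variable `u`,
then the origin is not an isolated top point of order `q`: the regular curve `{y_v = 0, y_z = ζ}` is `q`-fold.
[new] [Kollar2007 2.59.4 (v)] -/
theorem not_isolatedTop_of_mem_framePow {u v z : τ} (huv : u ≠ v) (huz : u ≠ z) (hvz : v ≠ z)
    {ζ : MvPolynomial τ L} (hζ : (∀ μ ∈ ζ.support, μ z = 0)) (hζ1 : (1 : ℕ∞) ≤ ordZero ζ) {q : ℕ} {F : MvPolynomial τ L}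
    (hF : F ∈ Ideal.span {(X v : MvPolynomial τ L), X z - ζ} ^ q) : ¬ TightDefectClasses.IsolatedTop q F := by
  classical
  rintro ⟨N, g, hg0, hg⟩
  -- the substitution `y_z ↦ ζ₀ := ζ(y_v ↦ 0)`, then `y_v ↦ 0`
  set ζ₀ : MvPolynomial τ L := vsubst v 0 ζ with hζ₀
  set φ : MvPolynomial τ L →ₐ[L] MvPolynomial τ L := (vsubst v 0).comp (vsubst z ζ₀) with hφ
  have h0top : (1 : ℕ∞) ≤ ordZero (0 : MvPolynomial τ L) := by
    rw [ordZero_eq_top_iff.mpr rfl]; exact le_top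
  have hζ₀v : (∀ μ ∈ ζ₀.support, μ v = 0) :=
    varFree_vsubst (fun d hd => absurd hd (by rw [MvPolynomial.support_zero]; exact Finset.notMem_empty d)) ζ
  have hζ₀1 : (1 : ℕ∞) ≤ ordZero ζ₀ := hζ1.trans (le_ordZero_vsubst h0top ζ)
  have hφv : φ (X v) = 0 := by
    rw [hφ, AlgHom.comp_apply, vsubst_X_of_ne hvz, vsubst_X_self]
  have hφz : φ (X z - ζ) = 0 := by
    rw [hφ, AlgHom.comp_apply, map_sub, vsubst_X_self, vsubst_of_varFree ζ₀ hζ, map_sub,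
      vsubst_of_varFree 0 hζ₀v, ← hζ₀, sub_self]
  have hφu : φ (X u) = X u := by
    rw [hφ, AlgHom.comp_apply, vsubst_X_of_ne huz, vsubst_X_of_ne huv]
  have hker : Ideal.span {(X v : MvPolynomial τ L), X z - ζ} ≤ RingHom.ker (φ : MvPolynomial τ L →+* MvPolynomial τ L) := by
    rw [Ideal.span_le]
    rintro x hx
    rcases hx with rfl | rfl
    · exact hφv
    · simpa using hφz
  have hmem : g * X u ^ N ∈ RingHom.ker (φ : MvPolynomial τ L →+* MvPolynomial τ L) :=
    hker (topIdeal_le_of_mem_pow hF (hg u))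
  have hzero : φ g * X u ^ N = 0 := by
    have h := (RingHom.mem_ker).mp hmem
    rwa [RingHom.coe_coe, map_mul, map_pow, hφu] at h
  have hg' : φ g = 0 := by
    rcases mul_eq_zero.mp hzero with h | h
    · exact h
    · exact absurd h (pow_ne_zero _ (X_ne_zero u))
  apply hg0
  have hcc : constantCoeff (φ g) = constantCoeff g := by
    rw [hφ, AlgHom.comp_apply, constantCoeff_vsubst h0top, constantCoeff_vsubst hζ₀1]
  rw [← hcc, hg', map_zero]

omit [DecidableEq L] in
/-- **K3, assembled with §7.**  On a valid frame, if every shifted support point of every row has its `v`-coordinate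
inside, the E-model `y^r · G` with `r_v + s ≥ q`... — stated in the form the assembly uses: `y^r G ∈ 𝔓^q` as soon
as `G ∈ 𝔓^s` and `r_v + s ≥ q` (the exponent identity `δ + s = q` of a balanced tail). [new] -/
theorem monomial_mul_mem_framePow {v z : τ} {ζ : MvPolynomial τ L} {s q : ℕ} {r : τ →₀ ℕ} (hr : q ≤ r v + s)
    {G : MvPolynomial τ L} (hG : G ∈ Ideal.span {(X v : MvPolynomial τ L), X z - ζ} ^ s) :
    monomial r 1 * G ∈ Ideal.span {(X v : MvPolynomial τ L), X z - ζ} ^ q := by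
  classical
  set J : Ideal (MvPolynomial τ L) := Ideal.span {(X v : MvPolynomial τ L), X z - ζ} with hJ
  have hv : (X v : MvPolynomial τ L) ^ r v ∈ J ^ r v := Ideal.pow_mem_pow (Ideal.subset_span (by simp)) _
  have hr' : r - Finsupp.single v (r v) + Finsupp.single v (r v) = r := by
    ext i
    rw [Finsupp.add_apply, Finsupp.tsub_apply, Finsupp.single_apply]
    by_cases h : v = i
    · subst h; simp
    · simp [h]
  have hsplit : (monomial r (1 : L) : MvPolynomial τ L) = monomial (r - Finsupp.single v (r v)) 1 * X v ^ r v := by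
    rw [X_pow_eq_monomial, monomial_mul, one_mul, hr']
  rw [hsplit, mul_assoc]
  refine Ideal.mul_mem_left _ _ (Ideal.pow_le_pow_right hr ?_)
  rw [pow_add]
  exact Ideal.mul_mem_mul hv hG

/-! ### K3 with a wall-far remainder (the form the finite-horizon assembly uses: `topIdeal q F ⊆ 𝔓 + (y_u^Λ)`,
and a unit times `y_u^M`, `M < Λ`, is not in `𝔓 + (y_u^Λ)` — the depth `Λ` is chosen AFTER the isolation exponent `M`). -/

omit [DecidableEq τ] [DecidableEq L] in
/-- `(I ⊔ J)^n ≤ I^n ⊔ J`. [folklore] -/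
theorem sup_pow_le_pow_sup (I J : Ideal (MvPolynomial τ L)) : ∀ n : ℕ, (I ⊔ J) ^ n ≤ I ^ n ⊔ J := by
  intro n
  induction n with
  | zero => simp
  | succ n ih =>
    rw [pow_succ, pow_succ]
    calc (I ⊔ J) ^ n * (I ⊔ J) ≤ (I ^ n ⊔ J) * (I ⊔ J) := Ideal.mul_mono_left ih
      _ ≤ I ^ n * I ⊔ J := by
          rw [Ideal.sup_mul, Ideal.mul_sup, Ideal.mul_sup]
          refine sup_le (sup_le le_sup_left ?_) (sup_le ?_ ?_)
          · exact le_sup_of_le_right Ideal.mul_le_left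
          · exact le_sup_of_le_right Ideal.mul_le_right
          · exact le_sup_of_le_right Ideal.mul_le_right

omit [DecidableEq τ] [DecidableEq L] in
/-- The two-wall power sits inside the frame ideal plus the far `u`-power: `(y_u, y_v)^Λ ⊆ 𝔓 + (y_u^Λ)`. [folklore] -/
theorem span_pair_pow_le_frame_sup_far (u v z : τ) (ζ : MvPolynomial τ L) (Λ : ℕ) :
    Ideal.span {(X u : MvPolynomial τ L), X v} ^ Λ ≤
      Ideal.span {(X v : MvPolynomial τ L), X z - ζ} ⊔ Ideal.span {X u ^ Λ} := by
  have hsplit : Ideal.span {(X u : MvPolynomial τ L), X v} = Ideal.span {X u} ⊔ Ideal.span {X v} := by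
    rw [Ideal.span_insert]
  rw [hsplit]
  refine (sup_pow_le_pow_sup _ _ Λ).trans ?_
  rw [Ideal.span_singleton_pow, sup_comm]
  refine sup_le_sup_right ?_ _
  exact Ideal.span_mono (by simp)

omit [DecidableEq L] in
/-- **`topIdeal` WITH REMAINDER.**  `topIdeal q (A + B + C) ⊆ 𝔓 + (y_u^Λ)` for `A ∈ 𝔓^q`, `B ∈ (y_u, y_v)^{Λ + q}` and `C`
killed by all Hasse derivatives of order `0 < |d| < q` (in the walk: `C ∈ K[y^q]`). [new] -/
theorem topIdeal_le_frame_sup_far {u v z : τ} {ζ : MvPolynomial τ L} {q Λ : ℕ} {A B C : MvPolynomial τ L}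
    (hA : A ∈ Ideal.span {(X v : MvPolynomial τ L), X z - ζ} ^ q)
    (hB : B ∈ Ideal.span {(X u : MvPolynomial τ L), X v} ^ (Λ + q))
    (hC : ∀ d : τ →₀ ℕ, d ≠ 0 → d.degree < q → hasseDeriv L d C = 0) :
    TightDefectClasses.topIdeal q (A + B + C) ≤
      Ideal.span {(X v : MvPolynomial τ L), X z - ζ} ⊔ Ideal.span {X u ^ Λ} := by
  unfold TightDefectClasses.topIdeal
  rw [Ideal.span_le]
  rintro _ ⟨d, ⟨hd0, hdq⟩, rfl⟩
  show hasseDeriv L d (A + B + C) ∈ _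
  rw [map_add, map_add, hC d hd0 hdq, add_zero]
  refine Ideal.add_mem _ ?_ ?_
  · have h := hasseDeriv_mem_pow_sub _ q hA d
    have h1 : Ideal.span {(X v : MvPolynomial τ L), X z - ζ} ^ (q - d.degree) ≤
        Ideal.span {(X v : MvPolynomial τ L), X z - ζ} ^ 1 := Ideal.pow_le_pow_right (by omega)
    rw [pow_one] at h1
    exact Ideal.mem_sup_left (h1 h)
  · have h := hasseDeriv_mem_pow_sub _ (Λ + q) hB d
    have h1 : Ideal.span {(X u : MvPolynomial τ L), X v} ^ (Λ + q - d.degree) ≤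
        Ideal.span {(X u : MvPolynomial τ L), X v} ^ Λ := Ideal.pow_le_pow_right (by omega)
    exact span_pair_pow_le_frame_sup_far u v z ζ Λ (h1 h)

omit [DecidableEq L] in
/-- The frame-killing substitution `y_v ↦ 0`, `y_z ↦ ζ(y_u, 0)`: kills `𝔓 = (y_v, y_z − ζ)`, fixes `y_u` and constant terms.
[new] -/
theorem exists_frameKill {u v z : τ} (huv : u ≠ v) (huz : u ≠ z) (hvz : v ≠ z)
    {ζ : MvPolynomial τ L} (hζ : (∀ μ ∈ ζ.support, μ z = 0)) (hζ1 : (1 : ℕ∞) ≤ ordZero ζ) :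
    ∃ φ : MvPolynomial τ L →ₐ[L] MvPolynomial τ L,
      φ (X v) = 0 ∧ φ (X z - ζ) = 0 ∧ φ (X u) = X u ∧ ∀ g, constantCoeff (φ g) = constantCoeff g := by
  classical
  set ζ₀ : MvPolynomial τ L := vsubst v 0 ζ with hζ₀
  have h0top : (1 : ℕ∞) ≤ ordZero (0 : MvPolynomial τ L) := by
    rw [ordZero_eq_top_iff.mpr rfl]; exact le_top
  have hζ₀v : (∀ μ ∈ ζ₀.support, μ v = 0) :=
    varFree_vsubst (fun d hd => absurd hd (by rw [MvPolynomial.support_zero]; exact Finset.notMem_empty d)) ζ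
  have hζ₀1 : (1 : ℕ∞) ≤ ordZero ζ₀ := hζ1.trans (le_ordZero_vsubst h0top ζ)
  refine ⟨(vsubst v 0).comp (vsubst z ζ₀), ?_, ?_, ?_, fun g => ?_⟩
  · rw [AlgHom.comp_apply, vsubst_X_of_ne hvz, vsubst_X_self]
  · rw [AlgHom.comp_apply, map_sub, vsubst_X_self, vsubst_of_varFree ζ₀ hζ, map_sub,
      vsubst_of_varFree 0 hζ₀v, ← hζ₀, sub_self]
  · rw [AlgHom.comp_apply, vsubst_X_of_ne huz, vsubst_X_of_ne huv]
  · rw [AlgHom.comp_apply, constantCoeff_vsubst h0top, constantCoeff_vsubst hζ₀1]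

end IsolationTop

end Summit.ResolutionOfSingularities.ResolutionOfSingularities.Theorems.WallFrames
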